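import Mathlib.Analysis.SpecialFunctions.ImproperIntegrals
import Mathlib.MeasureTheory.Measure.Haar.InnerProductSpace
import Mathlib.MeasureTheory.Measure.Haar.NormedSpace
import Mathlib.MeasureTheory.Integral.Pi
import Literature.Analysis.FluidPDE.SverakLandauClassification
import HarnessLib

/-!
# Route LandauJetArena (AnomalousDissipation) — shell energy of the Landau field is `O(1/(c−1))`

Helper file for item stmt-AnomalousDissipation-1548 (`LandauOverDissipation`, support of route
`LandauJetArena`). For Karch–Pilarczyk's Landau field `v_c = landauAxisField e₁ c` (axis `e₁`, `ν = 1`,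
Karch–Pilarczyk 2011 (2.1); tree: `Literature.Analysis.FluidPDE.landauAxisField`,
`landauAxisField_single_zero`) we prove the ENERGY HALF of the item:

* `norm_sq_landauAxisField_le` — pointwise majorant on the shell `1 ≤ |x| ≤ 2`:
  `|v_c(x)|² ≤ 512/((4(c−1)+x₂²)(4(c−1)+x₃²))` (pure algebra, `normSq_components_le`: with `q = c|x|−x₁`,
  `|v_c|² ≤ 20/q²` and `4q ≥ 4(c−1) + x₂² + x₃²`);
* `integral_majorant` — Fubini on `ℝ³ ≅ ℝ × ℝ × ℝ` (`PiLp.volume_preserving_ofLp`,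
  `integral_fintype_prod_volume_eq_prod`) and `∫ dt/(a²+t²) = π/a` give the majorant's integral `π²/(c−1)`;
* `shell_energy_le` — `∫_{1<|x|<2} |v_c|² ≤ 512 π²/(c−1)` for `1 < c < 2`.

The dissipation half is `LandauJetArenaLandauOverDissipationGradient.lean`; the assembly with the force
`b(c)` is `LandauJetArenaLandauOverDissipation.lean`. Constants are deliberately crude (the true value is
`∫_A|v_c|² ∼ 32π/(3(c−1))`). Elementary real analysis. [folklore]
-/

-- every `Summits/AnomalousDissipation/AnomalousDissipation/Theorems` file repeats the sub-problem name
set_option linter.dupNamespace false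

noncomputable section

namespace Summit.AnomalousDissipation.AnomalousDissipation.Theorems.LandauOverDissipation

open MeasureTheory Real Set WithLp
open Literature.Analysis.FluidPDE


/-- Pointwise algebra behind the shell-energy bound: with `r² = a² + x₁² + x₂²`, `1 ≤ r ≤ 2`, `1 < c`,
the squared Karch–Pilarczyk components sum to at most `512/((4(c−1)+x₁²)(4(c−1)+x₂²))`. [folklore] -/
theorem normSq_components_le {c r a x1 x2 : ℝ} (hc : 1 < c) (hr1 : 1 ≤ r) (hr2 : r ≤ 2)
    (hrel : r ^ 2 = a ^ 2 + x1 ^ 2 + x2 ^ 2) :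
    (2 * (c * r ^ 2 - 2 * a * r + c * a ^ 2) / (r * (c * r - a) ^ 2)) ^ 2 +
      (2 * (x1 * (c * a - r)) / (r * (c * r - a) ^ 2)) ^ 2 +
      (2 * (x2 * (c * a - r)) / (r * (c * r - a) ^ 2)) ^ 2 ≤
      512 / ((4 * (c - 1) + x1 ^ 2) * (4 * (c - 1) + x2 ^ 2)) := by
  have hr0 : 0 < r := by linarith
  have ha : a ^ 2 ≤ r ^ 2 := by nlinarith [sq_nonneg x1, sq_nonneg x2]
  have har : a ≤ r := by nlinarith
  have har' : -r ≤ a := by nlinarith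
  set q := c * r - a with hq
  have hq_pos : 0 < q := by nlinarith
  have hρ : x1 ^ 2 + x2 ^ 2 = (r - a) * (r + a) := by nlinarith
  -- Step 1: the sum is at most 20 / q²
  have hN0 : 0 ≤ c * r ^ 2 - 2 * a * r + c * a ^ 2 := by nlinarith [sq_nonneg (r - a)]
  have hN1 : c * r ^ 2 - 2 * a * r + c * a ^ 2 ≤ 2 * r * q := by
    rw [hq]; nlinarith
  have hca : (c * a - r) ^ 2 ≤ q ^ 2 := by
    rw [hq]; nlinarith
  have hsum : (c * r ^ 2 - 2 * a * r + c * a ^ 2) ^ 2 + (x1 ^ 2 + x2 ^ 2) * (c * a - r) ^ 2 ≤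
      5 * r ^ 2 * q ^ 2 := by
    have h1 : (c * r ^ 2 - 2 * a * r + c * a ^ 2) ^ 2 ≤ (2 * r * q) ^ 2 :=
      pow_le_pow_left₀ hN0 hN1 2
    have h2 : (x1 ^ 2 + x2 ^ 2) * (c * a - r) ^ 2 ≤ r ^ 2 * q ^ 2 :=
      mul_le_mul (by nlinarith) hca (sq_nonneg _) (sq_nonneg _)
    nlinarith
  have hstep1 : (2 * (c * r ^ 2 - 2 * a * r + c * a ^ 2) / (r * (c * r - a) ^ 2)) ^ 2 +
      (2 * (x1 * (c * a - r)) / (r * (c * r - a) ^ 2)) ^ 2 +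
      (2 * (x2 * (c * a - r)) / (r * (c * r - a) ^ 2)) ^ 2 ≤ 20 / q ^ 2 := by
    rw [← hq, div_pow, div_pow, div_pow, ← add_div, ← add_div, div_le_div_iff₀ (by positivity)
      (by positivity)]
    have : (2 * (c * r ^ 2 - 2 * a * r + c * a ^ 2)) ^ 2 + (2 * (x1 * (c * a - r))) ^ 2 +
        (2 * (x2 * (c * a - r))) ^ 2 =
        4 * ((c * r ^ 2 - 2 * a * r + c * a ^ 2) ^ 2 + (x1 ^ 2 + x2 ^ 2) * (c * a - r) ^ 2) := by
      ring
    rw [this]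
    have h3 := mul_le_mul_of_nonneg_right hsum (sq_nonneg q)
    nlinarith [h3]
  -- Step 2: 4q ≥ S := 4(c-1) + x1² + x2² > 0
  have hq_ge : 4 * (c - 1) + x1 ^ 2 + x2 ^ 2 ≤ 4 * q := by
    rw [hq]
    nlinarith [mul_le_mul_of_nonneg_left (show r + a ≤ 4 by linarith) (show 0 ≤ r - a by linarith), hρ]
  have hε : 0 < c - 1 := by linarith
  have hS : 0 < 4 * (c - 1) + x1 ^ 2 + x2 ^ 2 := by positivity
  have hA : 0 < 4 * (c - 1) + x1 ^ 2 := by positivity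
  have hB : 0 < 4 * (c - 1) + x2 ^ 2 := by positivity
  calc _ ≤ 20 / q ^ 2 := hstep1
    _ ≤ 320 / (4 * (c - 1) + x1 ^ 2 + x2 ^ 2) ^ 2 := by
      rw [div_le_div_iff₀ (by positivity) (by positivity)]
      have h4 : (4 * (c - 1) + x1 ^ 2 + x2 ^ 2) ^ 2 ≤ (4 * q) ^ 2 := pow_le_pow_left₀ hS.le hq_ge 2
      nlinarith [h4]
    _ ≤ 512 / ((4 * (c - 1) + x1 ^ 2) * (4 * (c - 1) + x2 ^ 2)) := by
      rw [div_le_div_iff₀ (by positivity) (by positivity)]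
      have h5 : (4 * (c - 1) + x1 ^ 2) * (4 * (c - 1) + x2 ^ 2) ≤
          (4 * (c - 1) + x1 ^ 2 + x2 ^ 2) ^ 2 := by
        nlinarith [mul_nonneg hA.le (sq_nonneg x1), mul_nonneg hA.le (sq_nonneg x2),
          sq_nonneg (x2 ^ 2)]
      nlinarith [h5, sq_nonneg (4 * (c - 1) + x1 ^ 2 + x2 ^ 2)]

/-- Pointwise bound on the Landau field with axis `e₁` (Karch–Pilarczyk's `v_c`) on the shell
`1 ≤ |x| ≤ 2`: `|v_c(x)|² ≤ 512/((4(c−1)+x₁²)(4(c−1)+x₂²))` for `1 < c`. [folklore] -/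
theorem norm_sq_landauAxisField_le {c : ℝ} (hc : 1 < c) {x : EuclideanSpace ℝ (Fin 3)} (hx1 : 1 ≤ ‖x‖)
    (hx2 : ‖x‖ ≤ 2) :
    ‖landauAxisField (EuclideanSpace.single 0 1) c x‖ ^ 2 ≤
      512 / ((4 * (c - 1) + x 1 ^ 2) * (4 * (c - 1) + x 2 ^ 2)) := by
  have hx0 : x ≠ 0 := by
    intro h; rw [h, norm_zero] at hx1; linarith
  have hc' : 1 < |c| := by rwa [abs_of_pos (by linarith)]
  rw [landauAxisField_single_zero hc' hx0, EuclideanSpace.real_norm_sq_eq, Fin.sum_univ_three]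
  simp only [Matrix.cons_val_zero, Matrix.cons_val_one, Matrix.cons_val_two,
    Matrix.head_cons, Matrix.tail_cons]
  exact normSq_components_le hc hx1 hx2 (by rw [EuclideanSpace.real_norm_sq_eq, Fin.sum_univ_three])

/-- `∫_ℝ dt/(a² + t²) = π/a` for `a > 0`. [folklore] -/
theorem integral_inv_sq_add_sq {a : ℝ} (ha : 0 < a) : ∫ t : ℝ, (a ^ 2 + t ^ 2)⁻¹ = π / a := by
  have h1 : ∀ t : ℝ, (a ^ 2 + t ^ 2)⁻¹ = (a ^ 2)⁻¹ * (1 + (t / a) ^ 2)⁻¹ := by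
    intro t
    have ha' : a ≠ 0 := ha.ne'
    field_simp
  simp_rw [h1, integral_const_mul]
  have h2 := Measure.integral_comp_div (fun y : ℝ => (1 + y ^ 2)⁻¹) a
  rw [h2, integral_univ_inv_one_add_sq, abs_of_pos ha, smul_eq_mul]
  field_simp

/-- `t ↦ 1/(a² + t²)` is integrable on `ℝ` for `a > 0`. [folklore] -/
theorem integrable_inv_sq_add_sq {a : ℝ} (ha : 0 < a) : Integrable fun t : ℝ => (a ^ 2 + t ^ 2)⁻¹ := by
  have h1 : (fun t : ℝ => (a ^ 2 + t ^ 2)⁻¹) = fun t => (a ^ 2)⁻¹ * (1 + (t / a) ^ 2)⁻¹ := by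
    funext t
    have ha' : a ≠ 0 := ha.ne'
    field_simp
  rw [h1]
  exact (integrable_inv_one_add_sq.comp_div ha.ne').const_mul _

/-- The shell `A = {1 < |x| < 2}` is measurable. [folklore] -/
theorem measurableSet_shell : MeasurableSet {x : EuclideanSpace ℝ (Fin 3) | 1 < ‖x‖ ∧ ‖x‖ < 2} := by
  have : {x : EuclideanSpace ℝ (Fin 3) | 1 < ‖x‖ ∧ ‖x‖ < 2} =
      (fun x : EuclideanSpace ℝ (Fin 3) => ‖x‖) ⁻¹' Set.Ioo 1 2 := by
    ext x; simp
  rw [this]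
  exact (isOpen_Ioo.preimage continuous_norm).measurableSet

/-- The majorant `1_{[-2,2]}(y₀) (4ε+y₁²)⁻¹ (4ε+y₂²)⁻¹` on `ℝ³` as a product over the coordinates,
its integrability and its integral `4 · (π/(2√ε))² = π²/ε`. [folklore] -/
theorem integral_majorant {ε : ℝ} (hε : 0 < ε) :
    Integrable (fun x : EuclideanSpace ℝ (Fin 3) => ∏ i : Fin 3,
      (![(Icc (-2 : ℝ) 2).indicator (fun _ => (1 : ℝ)), fun t => ((2 * √ε) ^ 2 + t ^ 2)⁻¹,
        fun t => ((2 * √ε) ^ 2 + t ^ 2)⁻¹] i) (x i)) ∧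
    ∫ x : EuclideanSpace ℝ (Fin 3), ∏ i : Fin 3,
      (![(Icc (-2 : ℝ) 2).indicator (fun _ => (1 : ℝ)), fun t => ((2 * √ε) ^ 2 + t ^ 2)⁻¹,
        fun t => ((2 * √ε) ^ 2 + t ^ 2)⁻¹] i) (x i) = π ^ 2 / ε := by
  set h : Fin 3 → ℝ → ℝ := ![(Icc (-2 : ℝ) 2).indicator (fun _ => (1 : ℝ)),
    fun t => ((2 * √ε) ^ 2 + t ^ 2)⁻¹, fun t => ((2 * √ε) ^ 2 + t ^ 2)⁻¹] with hh
  have ha : 0 < 2 * √ε := by positivity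
  have hint : ∀ i, Integrable (h i) := by
    intro i
    fin_cases i
    · simp only [hh, Fin.zero_eta, Matrix.cons_val_zero]
      exact (integrable_indicator_iff measurableSet_Icc).2
        ((integrableOn_const_iff).2 (Or.inr (by simp)))
    · simpa [hh] using integrable_inv_sq_add_sq ha
    · simpa [hh] using integrable_inv_sq_add_sq ha
  have hmp := PiLp.volume_preserving_ofLp (Fin 3)
  have hemb := (MeasurableEquiv.toLp 2 (Fin 3 → ℝ)).symm.measurableEmbedding
  constructor
  · exact (hmp.integrable_comp_emb hemb).2 (Integrable.fintype_prod hint)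
  · rw [hmp.integral_comp hemb (fun y : Fin 3 → ℝ => ∏ i, h i (y i)),
      integral_fintype_prod_volume_eq_prod, Fin.prod_univ_three]
    simp only [hh, Matrix.cons_val_zero, Matrix.cons_val_one, Matrix.cons_val_two, Matrix.head_cons,
      Matrix.tail_cons]
    rw [integral_indicator_const _ measurableSet_Icc, integral_inv_sq_add_sq ha, Real.volume_real_Icc]
    have h4 : (2 * √ε) ^ 2 = 4 * ε := by
      rw [mul_pow, Real.sq_sqrt hε.le]; ring
    have hs : √ε ≠ 0 := (Real.sqrt_pos.2 hε).ne'
    norm_num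
    field_simp
    rw [Real.sq_sqrt hε.le]
    ring


/-- **Shell energy of the Landau field.** For `1 < c < 2`,
`∫_{1<|x|<2} |v_c(x)|² dx ≤ 512 π² / (c − 1)` (Karch–Pilarczyk's `v_c`, axis `e₁`, `ν = 1`). [folklore] -/
theorem shell_energy_le {c : ℝ} (hc1 : 1 < c) (hc2 : c < 2) :
    ∫ x in {x : EuclideanSpace ℝ (Fin 3) | 1 < ‖x‖ ∧ ‖x‖ < 2},
      ‖landauAxisField (EuclideanSpace.single 0 1) c x‖ ^ 2 ≤ 512 * π ^ 2 / (c - 1) := by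
  have hε : 0 < c - 1 := by linarith
  obtain ⟨hHint, hHval⟩ := integral_majorant hε
  set H : EuclideanSpace ℝ (Fin 3) → ℝ := fun x => ∏ i : Fin 3,
      (![(Icc (-2 : ℝ) 2).indicator (fun _ => (1 : ℝ)), fun t => ((2 * √(c - 1)) ^ 2 + t ^ 2)⁻¹,
        fun t => ((2 * √(c - 1)) ^ 2 + t ^ 2)⁻¹] i) (x i) with hH
  have h4 : (2 * √(c - 1)) ^ 2 = 4 * (c - 1) := by
    rw [mul_pow, Real.sq_sqrt hε.le]; ring
  have hHx : ∀ x : EuclideanSpace ℝ (Fin 3), H x = (Icc (-2 : ℝ) 2).indicator (fun _ => (1 : ℝ)) (x 0) *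
      ((4 * (c - 1) + x 1 ^ 2)⁻¹ * (4 * (c - 1) + x 2 ^ 2)⁻¹) := by
    intro x
    simp only [hH, Fin.prod_univ_three, Matrix.cons_val_zero, Matrix.cons_val_one, Matrix.cons_val_two,
      Matrix.head_cons, Matrix.tail_cons, h4, mul_assoc]
  have hHnn : ∀ x : EuclideanSpace ℝ (Fin 3), 0 ≤ H x := by
    intro x
    rw [hHx]
    refine mul_nonneg (Set.indicator_nonneg (fun _ _ => zero_le_one) _) (mul_nonneg ?_ ?_) <;>
      exact inv_nonneg.2 (by positivity)
  have hpt : ∀ x ∈ {x : EuclideanSpace ℝ (Fin 3) | 1 < ‖x‖ ∧ ‖x‖ < 2},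
      ‖landauAxisField (EuclideanSpace.single 0 1) c x‖ ^ 2 ≤ 512 * H x := by
    intro x hx
    have hb := norm_sq_landauAxisField_le hc1 hx.1.le hx.2.le
    have hx0 : x 0 ∈ Icc (-2 : ℝ) 2 := by
      have h3 : ‖x‖ ^ 2 = x 0 ^ 2 + x 1 ^ 2 + x 2 ^ 2 := by
        rw [EuclideanSpace.real_norm_sq_eq, Fin.sum_univ_three]
      have h5 : ‖x‖ ^ 2 ≤ 4 := by nlinarith [hx.2, norm_nonneg x]
      constructor <;> nlinarith [sq_nonneg (x 1), sq_nonneg (x 2)]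
    rw [hHx, Set.indicator_of_mem hx0, one_mul, ← mul_inv, ← div_eq_mul_inv]
    exact hb
  calc ∫ x in {x : EuclideanSpace ℝ (Fin 3) | 1 < ‖x‖ ∧ ‖x‖ < 2},
        ‖landauAxisField (EuclideanSpace.single 0 1) c x‖ ^ 2
      ≤ ∫ x in {x : EuclideanSpace ℝ (Fin 3) | 1 < ‖x‖ ∧ ‖x‖ < 2}, 512 * H x :=
        integral_mono_of_nonneg (Filter.Eventually.of_forall fun x => sq_nonneg _)
          (hHint.const_mul 512).integrableOn (ae_restrict_of_forall_mem measurableSet_shell hpt)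
    _ ≤ ∫ x, 512 * H x := setIntegral_le_integral (hHint.const_mul 512)
          (Filter.Eventually.of_forall fun x => mul_nonneg (by norm_num) (hHnn x))
    _ = 512 * π ^ 2 / (c - 1) := by
        rw [integral_const_mul, hHval, mul_div_assoc]

end Summit.AnomalousDissipation.AnomalousDissipation.Theorems.LandauOverDissipation
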